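/-
Copyright (c) 2026 the pub-hodgecm-mathlib formalisation cell (harness21).  Prover seat hodgecm-mathlib-K2Liu-p03 (g6): Track B «K2-LIT»,
#184♮ = hLiu418 = stmt-HodgeConjecture-24832, road `K2_Liu`, Road I organ (A-int)-fin, A7-reg (GK COCYCLE road), file B1a-3
(K2Liu-p09 (g5) «B1b NEEDS» ADDENDUM 2026-09-04T08:17:10Z: the general Siegel-Levi letter `m(A)`).
-/
import Summits.HodgeConjecture.HodgeConjecture.Theorems.K2LiuDoubledUTwoTwoWeylCocycle   -- ★ B1a-2 (⇒ B1a-1)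
import HarnessLib

/-!
# Crux `HLiu418`, road `K2_Liu`, organ (A-int)-fin, A7-reg file B1a-3: THE SIEGEL-LEVI LETTER `m(A) = diag(A, W σ(A)⁻ᵀ W)` OF `U(J₄)`,
# the block-parametrised Siegel unipotent `n(X)`, and the adjoint action `m(A) n(X) m(A)⁻¹ = n(A X W σ(A)ᵀ W)`

Cell `hodgecm-mathlib`, crux item hLiu418 = `stmt-HodgeConjecture-24832`; squad K2 ∕ K2Liu; prover K2Liu-p03 (g6).  DEFINITIONS WITH BODIES + their
algebra (review lane `--kind definition`, `--supports stmt-HodgeConjecture-24832 --as helper`); no `instance`, no notation, no named-fact hypothesis, no `sorry`.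
Setting of ★ B1a-1 `K2LiuDoubledUTwoTwoBorelFrame` (`R`, `σ`, `hσ`, `J₄ = antidiagFour`, `G = unitaryGroupOfForm σ ((StdForm.antidiagonal 4).over R)`), `W = antidiag(1,1) ∈ M₂(R)`.
* §1 `antidiagTwo` (`W`) and the skew condition `IsSkewTwo X : σ(X)ᵀ W + W X = 0` of the Siegel unipotent radical (`N_Δ ≅ {X}`), closed under `X ↦ A X W σ(A)ᵀ W`.
* §2 **`leviElt A`** for `A ∈ GL₂(R)`: matrix `diag(A, W σ(A)⁻ᵀ W)`; `leviElt_mul`, `leviElt_one`, `leviElt_inv`; the torus and `w₁` are instances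
  (`leviElt_eq_torusElt`, `leviElt_eq_weylOne`) — so at a SPLIT place the partial Weyl letters `m(ε_w W + (1−ε_w) 1)` are available to B4 (K2Liu-p09).
* §3 **`nSiegelBlk X hX`** (`= (1 X; 0 1)`), the bridge `nSiegel_eq_nSiegelBlk` (`n(x,z,y) = n((z y; x −σz))`), and THE ADJOINT ACTION
  **`leviElt_mul_nSiegelBlk : m(A) · n(X) = n(A X W σ(A)ᵀ W) · m(A)`**; the commutator instance `uMinus a · uLongTwo x = nSiegel x (a x) (a σ(a) x) · uMinus a`
  (`[U_{α₁}, U_{α₂}] ⊂ U_{α₁+α₂} U_{2α₁+α₂}` — the `N = U_α N^α` relation of the `α₂`-step).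
HONEST LABEL.  Carriers only, count-neutral: `HC_CM` is proved only modulo the 7 printed citations (2 remaining named inputs: hLiu418 = `stmt-HodgeConjecture-24832`,
h413 = `stmt-HodgeConjecture-24833`) until rung 0 closes.

## References
* [HarrisKudlaSweet1996] M. Harris, S. Kudla, W. J. Sweet, J. AMS 9 (1996): §1 (1.11)–(1.12) (`P_Δ = M_Δ N_Δ`, `m(a) n(b) m(a)⁻¹ = n(a b a*)`).
* [Casselman1980] W. Casselman, Compositio Math. 40 (1980): §3.   * [Mok2014] C. P. Mok, Mem. AMS 235 (2015): §1 Notation p. 5.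
-/

set_option autoImplicit false
set_option linter.dupNamespace false -- the mandated namespace repeats `HodgeConjecture.HodgeConjecture`

noncomputable section

open Matrix
open Literature.NumberTheory.Automorphic
open Summit.HodgeConjecture.HodgeConjecture.Cruxes.HLiu418.K2LiuDoubledUTwoTwoBorelFrame
open Summit.HodgeConjecture.HodgeConjecture.Cruxes.HLiu418.K2LiuDoubledUTwoTwoWeylCocycle

namespace Summit.HodgeConjecture.HodgeConjecture.Cruxes.HLiu418.K2LiuDoubledUTwoTwoLevi

variable (R : Type*) [CommRing R] (σ : R →+* R)

/-! ## §1 `W = antidiag(1,1)` and the skew condition of the Siegel unipotent radical -/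

/-- `W = antidiag(1, 1) ∈ M₂(R)` (the off-diagonal block of `J₄ = (0 W; W 0)`). [cite: Mok2014, §1 Notation p. 5] -/
def antidiagTwo : Matrix (Fin 2) (Fin 2) R := !![0, 1; 1, 0]

/-- `W² = 1`. [cite: Mok2014, §1 Notation p. 5] -/
theorem antidiagTwo_mul_self : antidiagTwo R * antidiagTwo R = 1 := by
  ext i j; fin_cases i <;> fin_cases j <;> simp [antidiagTwo]

/-- **the skew condition** `σ(X)ᵀ W + W X = 0` cutting out the Siegel unipotent radical `{(1 X; 0 1)} ≤ U(J₄)` (`W X` is `σ`-skew-hermitian).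
[cite: HarrisKudlaSweet1996, §1 (1.11)] -/
def IsSkewTwo (X : Matrix (Fin 2) (Fin 2) R) : Prop := (X.map σ)ᵀ * antidiagTwo R + antidiagTwo R * X = 0

variable {R σ} in
/-- the coordinates `(z y; x −σz)` with `σ x = −x`, `σ y = −y` satisfy the skew condition. [cite: HarrisKudlaSweet1996, §1 (1.11)] -/
theorem isSkewTwo_coords (hσ : ∀ x, σ (σ x) = x) (x z y : R) (hx : σ x = -x) (hy : σ y = -y) : IsSkewTwo R σ !![z, y; x, -σ z] := by
  unfold IsSkewTwo
  ext i j; fin_cases i <;> fin_cases j <;> simp [antidiagTwo, Matrix.mul_apply, Fin.sum_univ_two, hx, hy, hσ]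

variable {R σ} in
/-- the four entry relations of the skew condition: `σ(X_{1−l,k}) + X_{1−k,l} = 0`. [cite: HarrisKudlaSweet1996, §1 (1.11)] -/
theorem IsSkewTwo.entries {X : Matrix (Fin 2) (Fin 2) R} (hX : IsSkewTwo R σ X) :
    σ (X 1 0) + X 1 0 = 0 ∧ σ (X 0 0) + X 1 1 = 0 ∧ σ (X 1 1) + X 0 0 = 0 ∧ σ (X 0 1) + X 0 1 = 0 := by
  unfold IsSkewTwo at hX
  refine ⟨?_, ?_, ?_, ?_⟩
  · simpa [antidiagTwo, Matrix.mul_apply, Fin.sum_univ_two, Matrix.add_apply, Matrix.vecMul, dotProduct] using congrFun (congrFun hX 0) 0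
  · simpa [antidiagTwo, Matrix.mul_apply, Fin.sum_univ_two, Matrix.add_apply, Matrix.vecMul, dotProduct] using congrFun (congrFun hX 0) 1
  · simpa [antidiagTwo, Matrix.mul_apply, Fin.sum_univ_two, Matrix.add_apply, Matrix.vecMul, dotProduct] using congrFun (congrFun hX 1) 0
  · simpa [antidiagTwo, Matrix.mul_apply, Fin.sum_univ_two, Matrix.add_apply, Matrix.vecMul, dotProduct] using congrFun (congrFun hX 1) 1

variable {R σ} in
/-- **the skew condition is stable under the adjoint action** `X ↦ A X W σ(A)ᵀ W` of `GL₂(R)` (`σ(Y)ᵀ W + W Y = (W A W)(σ(X)ᵀ W + W X)(W σ(A)ᵀ W)`).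
[cite: HarrisKudlaSweet1996, §1 (1.11)] -/
theorem IsSkewTwo.conj (hσ : ∀ x, σ (σ x) = x) {X : Matrix (Fin 2) (Fin 2) R} (hX : IsSkewTwo R σ X) (A : Matrix (Fin 2) (Fin 2) R) :
    IsSkewTwo R σ (A * X * (antidiagTwo R * (A.map σ)ᵀ * antidiagTwo R)) := by
  obtain ⟨e00, e01, e10, e11⟩ := hX.entries
  unfold IsSkewTwo
  ext i j
  fin_cases i <;> fin_cases j <;> simp [antidiagTwo, Matrix.mul_apply, Fin.sum_univ_two, Matrix.add_apply, Matrix.vecMul, dotProduct, hσ]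
  · linear_combination A 1 1 * σ (A 1 1) * e00 + A 1 1 * σ (A 1 0) * e01 + A 1 0 * σ (A 1 1) * e10 + A 1 0 * σ (A 1 0) * e11
  · linear_combination A 1 1 * σ (A 0 1) * e00 + A 1 1 * σ (A 0 0) * e01 + A 1 0 * σ (A 0 1) * e10 + A 1 0 * σ (A 0 0) * e11
  · linear_combination A 0 1 * σ (A 1 1) * e00 + A 0 1 * σ (A 1 0) * e01 + A 0 0 * σ (A 1 1) * e10 + A 0 0 * σ (A 1 0) * e11
  · linear_combination A 0 1 * σ (A 0 1) * e00 + A 0 1 * σ (A 0 0) * e01 + A 0 0 * σ (A 0 1) * e10 + A 0 0 * σ (A 0 0) * e11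

/-! ## §2 The Siegel-Levi letter `m(A) = diag(A, W σ(A)⁻ᵀ W)` -/

/-- matrix of `m(A)`: upper block `A`, lower block `W σ(A⁻¹)ᵀ W` (entries `σ((A⁻¹)_{1−j,1−i})`, matrix inverse of `↑A`). [cite: HarrisKudlaSweet1996, §1 (1.11)] -/
def leviM (A : GL (Fin 2) R) : Matrix (Fin 4) (Fin 4) R :=
  !![(A : Matrix (Fin 2) (Fin 2) R) 0 0, (A : Matrix (Fin 2) (Fin 2) R) 0 1, 0, 0;
     (A : Matrix (Fin 2) (Fin 2) R) 1 0, (A : Matrix (Fin 2) (Fin 2) R) 1 1, 0, 0;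
     0, 0, σ ((A : Matrix (Fin 2) (Fin 2) R)⁻¹ 1 1), σ ((A : Matrix (Fin 2) (Fin 2) R)⁻¹ 0 1);
     0, 0, σ ((A : Matrix (Fin 2) (Fin 2) R)⁻¹ 1 0), σ ((A : Matrix (Fin 2) (Fin 2) R)⁻¹ 0 0)]

variable {R} in
/-- the four entry relations of `A⁻¹ A = 1` (matrix inverse of `↑A`, `A ∈ GL₂(R)`). [folklore] -/
theorem inv_mul_entries (A : GL (Fin 2) R) :
    (A : Matrix (Fin 2) (Fin 2) R)⁻¹ 0 0 * (A : Matrix (Fin 2) (Fin 2) R) 0 0 + (A : Matrix (Fin 2) (Fin 2) R)⁻¹ 0 1 * (A : Matrix (Fin 2) (Fin 2) R) 1 0 = 1 ∧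
      (A : Matrix (Fin 2) (Fin 2) R)⁻¹ 0 0 * (A : Matrix (Fin 2) (Fin 2) R) 0 1 + (A : Matrix (Fin 2) (Fin 2) R)⁻¹ 0 1 * (A : Matrix (Fin 2) (Fin 2) R) 1 1 = 0 ∧
      (A : Matrix (Fin 2) (Fin 2) R)⁻¹ 1 0 * (A : Matrix (Fin 2) (Fin 2) R) 0 0 + (A : Matrix (Fin 2) (Fin 2) R)⁻¹ 1 1 * (A : Matrix (Fin 2) (Fin 2) R) 1 0 = 0 ∧
      (A : Matrix (Fin 2) (Fin 2) R)⁻¹ 1 0 * (A : Matrix (Fin 2) (Fin 2) R) 0 1 + (A : Matrix (Fin 2) (Fin 2) R)⁻¹ 1 1 * (A : Matrix (Fin 2) (Fin 2) R) 1 1 = 1 := by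
  have h : (A : Matrix (Fin 2) (Fin 2) R)⁻¹ * (A : Matrix (Fin 2) (Fin 2) R) = 1 := by
    rw [← Matrix.coe_units_inv, ← Units.val_mul, inv_mul_cancel, Units.val_one]
  refine ⟨?_, ?_, ?_, ?_⟩
  · simpa [Matrix.mul_apply, Fin.sum_univ_two] using congrFun (congrFun h 0) 0
  · simpa [Matrix.mul_apply, Fin.sum_univ_two] using congrFun (congrFun h 0) 1
  · simpa [Matrix.mul_apply, Fin.sum_univ_two] using congrFun (congrFun h 1) 0
  · simpa [Matrix.mul_apply, Fin.sum_univ_two] using congrFun (congrFun h 1) 1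

variable {R} in
/-- the four entry relations of `A A⁻¹ = 1`. [folklore] -/
theorem mul_inv_entries (A : GL (Fin 2) R) :
    (A : Matrix (Fin 2) (Fin 2) R) 0 0 * (A : Matrix (Fin 2) (Fin 2) R)⁻¹ 0 0 + (A : Matrix (Fin 2) (Fin 2) R) 0 1 * (A : Matrix (Fin 2) (Fin 2) R)⁻¹ 1 0 = 1 ∧
      (A : Matrix (Fin 2) (Fin 2) R) 0 0 * (A : Matrix (Fin 2) (Fin 2) R)⁻¹ 0 1 + (A : Matrix (Fin 2) (Fin 2) R) 0 1 * (A : Matrix (Fin 2) (Fin 2) R)⁻¹ 1 1 = 0 ∧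
      (A : Matrix (Fin 2) (Fin 2) R) 1 0 * (A : Matrix (Fin 2) (Fin 2) R)⁻¹ 0 0 + (A : Matrix (Fin 2) (Fin 2) R) 1 1 * (A : Matrix (Fin 2) (Fin 2) R)⁻¹ 1 0 = 0 ∧
      (A : Matrix (Fin 2) (Fin 2) R) 1 0 * (A : Matrix (Fin 2) (Fin 2) R)⁻¹ 0 1 + (A : Matrix (Fin 2) (Fin 2) R) 1 1 * (A : Matrix (Fin 2) (Fin 2) R)⁻¹ 1 1 = 1 := by
  have h : (A : Matrix (Fin 2) (Fin 2) R) * (A : Matrix (Fin 2) (Fin 2) R)⁻¹ = 1 := by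
    rw [← Matrix.coe_units_inv, ← Units.val_mul, mul_inv_cancel, Units.val_one]
  refine ⟨?_, ?_, ?_, ?_⟩
  · simpa [Matrix.mul_apply, Fin.sum_univ_two] using congrFun (congrFun h 0) 0
  · simpa [Matrix.mul_apply, Fin.sum_univ_two] using congrFun (congrFun h 0) 1
  · simpa [Matrix.mul_apply, Fin.sum_univ_two] using congrFun (congrFun h 1) 0
  · simpa [Matrix.mul_apply, Fin.sum_univ_two] using congrFun (congrFun h 1) 1

variable {R σ} in
/-- `m(A)` preserves `J₄` (`σ` involutive). [cite: HarrisKudlaSweet1996, §1 (1.11)] -/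
theorem leviM_unitary (hσ : ∀ x, σ (σ x) = x) (A : GL (Fin 2) R) : ((leviM R σ A).map σ)ᵀ * antidiagFour R * leviM R σ A = antidiagFour R := by
  obtain ⟨s1, s2, s3, s4⟩ := inv_mul_entries A
  have t1 := congrArg σ s1; have t2 := congrArg σ s2; have t3 := congrArg σ s3; have t4 := congrArg σ s4
  simp only [map_add, map_mul, map_one, map_zero] at t1 t2 t3 t4
  ext i j
  fin_cases i <;> fin_cases j <;> simp [leviM, antidiagFour, Matrix.mul_apply, Fin.sum_univ_four, hσ] <;>
    first
    | linear_combination t3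
    | linear_combination t1
    | linear_combination t4
    | linear_combination t2
    | linear_combination s3
    | linear_combination s4
    | linear_combination s1
    | linear_combination s2

/-- **the Siegel-Levi letter `m(A) ∈ U(J₄)`**, `A ∈ GL₂(R)` (`M_Δ ≅ GL₂(E)` at a place; at a split place `GL₂(E_w) × GL₂(E_{w̄})`).
[cite: HarrisKudlaSweet1996, §1 (1.11)] [cite: Casselman1980, §3] -/
def leviElt (hσ : ∀ x, σ (σ x) = x) (A : GL (Fin 2) R) : unitaryGroupOfForm σ ((StdForm.antidiagonal 4).over R) :=
  unitaryOfMatrix' R σ (leviM R σ A) (leviM_unitary hσ A)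

/-- matrix of `leviElt`. [cite: HarrisKudlaSweet1996, §1 (1.11)] -/
@[simp] theorem coe_leviElt (hσ : ∀ x, σ (σ x) = x) (A : GL (Fin 2) R) :
    (((leviElt R σ hσ A : unitaryGroupOfForm σ _) : GL (Fin 4) R) : Matrix (Fin 4) (Fin 4) R) = leviM R σ A := rfl

/-- **`m(A) m(B) = m(A B)`**. [cite: HarrisKudlaSweet1996, §1 (1.11)] -/
theorem leviElt_mul (hσ : ∀ x, σ (σ x) = x) (A B : GL (Fin 2) R) : leviElt R σ hσ A * leviElt R σ hσ B = leviElt R σ hσ (A * B) := by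
  apply ext_of_coe
  rw [Subgroup.coe_mul, Units.val_mul, coe_leviElt, coe_leviElt, coe_leviElt]
  ext i j
  fin_cases i <;> fin_cases j <;> simp [leviM, Matrix.mul_apply, Fin.sum_univ_four, Fin.sum_univ_two, Matrix.mul_inv_rev] <;> ring

/-- `m(1) = 1`. [cite: HarrisKudlaSweet1996, §1 (1.11)] -/
theorem leviElt_one (hσ : ∀ x, σ (σ x) = x) : leviElt R σ hσ 1 = 1 := by
  apply ext_of_coe
  rw [coe_leviElt, Subgroup.coe_one, Units.val_one]
  ext i j; fin_cases i <;> fin_cases j <;> simp [leviM]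

/-- `m(A)⁻¹ = m(A⁻¹)`. [cite: HarrisKudlaSweet1996, §1 (1.11)] -/
theorem leviElt_inv (hσ : ∀ x, σ (σ x) = x) (A : GL (Fin 2) R) : (leviElt R σ hσ A)⁻¹ = leviElt R σ hσ A⁻¹ := by
  rw [eq_comm, ← mul_eq_one_iff_eq_inv, leviElt_mul, inv_mul_cancel, leviElt_one]

/-- **the torus is a Levi letter**: `m(diag(a,b)) = t(a,b)` for any `A ∈ GL₂(R)` with matrix `diag(a,b)`. [cite: Casselman1980, §3] -/
theorem leviElt_eq_torusElt (hσ : ∀ x, σ (σ x) = x) (a b : Rˣ) (A : GL (Fin 2) R)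
    (hA : (A : Matrix (Fin 2) (Fin 2) R) = !![(a : R), 0; 0, (b : R)]) : leviElt R σ hσ A = torusElt R σ hσ a b := by
  have hAi : (A : Matrix (Fin 2) (Fin 2) R)⁻¹ = !![((a⁻¹ : Rˣ) : R), 0; 0, ((b⁻¹ : Rˣ) : R)] := by
    rw [hA]
    refine Matrix.inv_eq_left_inv ?_
    ext i j; fin_cases i <;> fin_cases j <;> simp [Matrix.mul_apply, Fin.sum_univ_two]
  apply ext_of_coe
  rw [coe_leviElt, coe_torusElt]
  unfold leviM
  rw [hAi, hA]
  ext i j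
  fin_cases i <;> fin_cases j <;> simp [torusM]

/-- **`w₁` is a Levi letter**: `m(W) = w₁` for any `A ∈ GL₂(R)` with matrix `W = antidiag(1,1)`. [cite: Casselman1980, §3] -/
theorem leviElt_eq_weylOne (hσ : ∀ x, σ (σ x) = x) (A : GL (Fin 2) R) (hA : (A : Matrix (Fin 2) (Fin 2) R) = !![0, 1; 1, 0]) :
    leviElt R σ hσ A = weylOne R σ := by
  have hAi : (A : Matrix (Fin 2) (Fin 2) R)⁻¹ = !![0, 1; 1, 0] := by
    rw [hA]
    refine Matrix.inv_eq_left_inv ?_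
    ext i j; fin_cases i <;> fin_cases j <;> simp [Matrix.mul_apply, Fin.sum_univ_two]
  apply ext_of_coe
  rw [coe_leviElt, coe_weylOne]
  unfold leviM
  rw [hAi, hA]
  ext i j
  fin_cases i <;> fin_cases j <;> simp [weylOneM]

/-! ## §3 The block-parametrised Siegel unipotent and the adjoint action of the Levi -/

/-- matrix `(1 X; 0 1)`. [cite: HarrisKudlaSweet1996, §1 (1.11)] -/
def nSiegelBlkM (X : Matrix (Fin 2) (Fin 2) R) : Matrix (Fin 4) (Fin 4) R := !![1, 0, X 0 0, X 0 1; 0, 1, X 1 0, X 1 1; 0, 0, 1, 0; 0, 0, 0, 1]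

variable {R σ} in
/-- `(1 X; 0 1)` preserves `J₄` iff the skew condition holds; here the forward direction. [cite: HarrisKudlaSweet1996, §1 (1.11)] -/
theorem nSiegelBlkM_unitary {X : Matrix (Fin 2) (Fin 2) R} (hX : IsSkewTwo R σ X) :
    ((nSiegelBlkM R X).map σ)ᵀ * antidiagFour R * nSiegelBlkM R X = antidiagFour R := by
  obtain ⟨e00, e01, e10, e11⟩ := hX.entries
  ext i j
  fin_cases i <;> fin_cases j <;> simp [nSiegelBlkM, antidiagFour, Matrix.mul_apply, Fin.sum_univ_four] <;>
    first
    | linear_combination e00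
    | linear_combination e01
    | linear_combination e10
    | linear_combination e11

/-- **the block-parametrised Siegel unipotent `n(X) = (1 X; 0 1) ∈ U(J₄)`** for skew `X`. [cite: HarrisKudlaSweet1996, §1 (1.11)] -/
def nSiegelBlk {X : Matrix (Fin 2) (Fin 2) R} (hX : IsSkewTwo R σ X) : unitaryGroupOfForm σ ((StdForm.antidiagonal 4).over R) :=
  unitaryOfMatrix' R σ (nSiegelBlkM R X) (nSiegelBlkM_unitary hX)

/-- matrix of `nSiegelBlk`. [cite: HarrisKudlaSweet1996, §1 (1.11)] -/
@[simp] theorem coe_nSiegelBlk {X : Matrix (Fin 2) (Fin 2) R} (hX : IsSkewTwo R σ X) :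
    (((nSiegelBlk R σ hX : unitaryGroupOfForm σ _) : GL (Fin 4) R) : Matrix (Fin 4) (Fin 4) R) = nSiegelBlkM R X := rfl

/-- **bridge to the coordinate letters**: `n(x,z,y) = n((z y; x −σz))`. [cite: HarrisKudlaSweet1996, §1 (1.11)] -/
theorem nSiegel_eq_nSiegelBlk (hσ : ∀ x, σ (σ x) = x) (x z y : R) (hx : σ x = -x) (hy : σ y = -y) :
    nSiegel R σ hσ x z y hx hy = nSiegelBlk R σ (isSkewTwo_coords hσ x z y hx hy) := by
  apply ext_of_coe
  rw [coe_nSiegel, coe_nSiegelBlk]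
  ext i j; fin_cases i <;> fin_cases j <;> rfl

/-- two skew proofs give the same element (proof irrelevance, for rewriting the parameter). [cite: HarrisKudlaSweet1996, §1 (1.11)] -/
theorem nSiegelBlk_congr {X Y : Matrix (Fin 2) (Fin 2) R} (hX : IsSkewTwo R σ X) (hY : IsSkewTwo R σ Y) (h : X = Y) :
    nSiegelBlk R σ hX = nSiegelBlk R σ hY := by
  subst h; rfl

/-- ★ **THE ADJOINT ACTION OF THE SIEGEL LEVI ON `N_Δ`**: `m(A) · n(X) = n(A X W σ(A)ᵀ W) · m(A)`, i.e. `m(A) n(X) m(A)⁻¹ = n(A X (W σ(A)ᵀ W))`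
(`W σ(A)ᵀ W = (W σ(A)⁻ᵀ W)⁻¹` is the inverse of the lower block). [cite: HarrisKudlaSweet1996, §1 (1.11)–(1.12)] -/
theorem leviElt_mul_nSiegelBlk (hσ : ∀ x, σ (σ x) = x) (A : GL (Fin 2) R) {X : Matrix (Fin 2) (Fin 2) R} (hX : IsSkewTwo R σ X) :
    leviElt R σ hσ A * nSiegelBlk R σ hX =
      nSiegelBlk R σ (hX.conj hσ (A : Matrix (Fin 2) (Fin 2) R)) * leviElt R σ hσ A := by
  obtain ⟨s1, s2, s3, s4⟩ := inv_mul_entries A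
  have t1 := congrArg σ s1; have t2 := congrArg σ s2; have t3 := congrArg σ s3; have t4 := congrArg σ s4
  simp only [map_add, map_mul, map_one, map_zero] at t1 t2 t3 t4
  apply ext_of_coe
  rw [Subgroup.coe_mul, Units.val_mul, Subgroup.coe_mul, Units.val_mul, coe_leviElt, coe_nSiegelBlk, coe_nSiegelBlk]
  ext i j
  fin_cases i <;> fin_cases j <;>
    simp [leviM, nSiegelBlkM, antidiagTwo, Matrix.mul_apply, Fin.sum_univ_four, Fin.sum_univ_two, Matrix.vecMul, dotProduct] <;>
    first
    | linear_combination (-((A : Matrix (Fin 2) (Fin 2) R) 0 0 * X 0 0 + (A : Matrix (Fin 2) (Fin 2) R) 0 1 * X 1 0)) * t4 -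
        ((A : Matrix (Fin 2) (Fin 2) R) 0 0 * X 0 1 + (A : Matrix (Fin 2) (Fin 2) R) 0 1 * X 1 1) * t3
    | linear_combination (-((A : Matrix (Fin 2) (Fin 2) R) 0 0 * X 0 0 + (A : Matrix (Fin 2) (Fin 2) R) 0 1 * X 1 0)) * t2 -
        ((A : Matrix (Fin 2) (Fin 2) R) 0 0 * X 0 1 + (A : Matrix (Fin 2) (Fin 2) R) 0 1 * X 1 1) * t1
    | linear_combination (-((A : Matrix (Fin 2) (Fin 2) R) 1 0 * X 0 0 + (A : Matrix (Fin 2) (Fin 2) R) 1 1 * X 1 0)) * t4 -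
        ((A : Matrix (Fin 2) (Fin 2) R) 1 0 * X 0 1 + (A : Matrix (Fin 2) (Fin 2) R) 1 1 * X 1 1) * t3
    | linear_combination (-((A : Matrix (Fin 2) (Fin 2) R) 1 0 * X 0 0 + (A : Matrix (Fin 2) (Fin 2) R) 1 1 * X 1 0)) * t2 -
        ((A : Matrix (Fin 2) (Fin 2) R) 1 0 * X 0 1 + (A : Matrix (Fin 2) (Fin 2) R) 1 1 * X 1 1) * t1

/-- **the commutator instance `[U_{α₁}, U_{α₂}]`**: `u_{e₁−e₂}(a) · u_{2e₂}(x) = n(x, a x, a σ(a) x) · u_{e₁−e₂}(a)` — conjugating the simple long root letter by the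
simple short one produces the `e₁+e₂` and `2e₁` components (the `N = U_α N^α` relation of the `α₂`-step of the cocycle). [cite: HarrisKudlaSweet1996, §1 (1.11)] [cite: Casselman1980, §3] -/
theorem uMinus_mul_uLongTwo (hσ : ∀ x, σ (σ x) = x) (a x : R) (hx : σ x = -x) :
    uMinus R σ hσ a * uLongTwo R σ x hx =
      nSiegel R σ hσ x (a * x) (a * σ a * x) hx (by rw [map_mul, map_mul, hσ, hx, mul_neg, mul_comm (σ a)]) * uMinus R σ hσ a := by
  apply ext_of_coe
  rw [Subgroup.coe_mul, Units.val_mul, Subgroup.coe_mul, Units.val_mul, coe_uMinus, coe_uLongTwo, coe_nSiegel]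
  ext i j
  fin_cases i <;> fin_cases j <;> simp [uMinusM, uLongTwoM, nSiegelM, Matrix.mul_apply, Fin.sum_univ_four, hx] <;> ring

end Summit.HodgeConjecture.HodgeConjecture.Cruxes.HLiu418.K2LiuDoubledUTwoTwoLevi

end
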